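import Summits.CriticalPhenomena.Ising3DConformalLimit.Theorems.PerfectScreeningGaussianLimitNotScreenedMarkovSquare
import Summits.CriticalPhenomena.Ising3DConformalLimit.Theorems.PerfectScreeningGaussianLimitNotScreenedRegressionMoments
import Literature.Probability.LatticeModels.CriticalTwoPointLower
import Literature.Probability.LatticeModels.HighDimPointwiseTriviality
import HarnessLib

/-!
# Crux `GaussianLimitNotScreened` (stmt-CriticalPhenomena-13886), line `single-layer-linear-regression`:
# the MARKOV REGRESSION IDENTITY in the thermodynamic limit (the planner's stub M, recomposed)

THEOREM-ONLY file. The planner's / lead c1's registered stub `stub_markovRegression`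

  `E_L[(E_L[σ_{(n,0,0)} | layer] − Σ_{u∈s} c_u σ_{(0,u)})²] → G(2n e₀) − 2Σ c_u G(n,u) + ΣΣ c_uc_v G(0,u−v)`  (`L → ∞`)

is now a THEOREM: it is glued (lead c2's skeleton glue `markovRegression_of_stubs`, moved here verbatim) from the
two LANDED stubs of lead c2's reshape — M1 `stub_markovSquare` (the finite-volume nearest-neighbour Markov identity
`E_L[(E_L[σ_x|layer])²] = E_L[σ_xσ_{θx}]`, Theorems/…MarkovSquare.lean, p128323) and M2 `stub_regressionMoments`
(tower property + box limits, Theorems/…RegressionMoments.lean, p127710) — using the lattice symmetries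
`G(−x) = G(x)` (`criticalTwoPoint_neg`) and `G(−n,u) = G(n,u)` (`twoPointPlus_reflection_invariant_holds`).

References: J. Glimm, A. Jaffe, *Quantum Physics* (1987), §6.1 pp. 89–90; S. Friedli, Y. Velenik (2017), Thm. 3.17,
Exercise 3.14.
-/

noncomputable section

namespace Summit.CriticalPhenomena.Ising3DConformalLimit.Cruxes.GaussianLimitNotScreened.SingleLayerLinearRegression

open MeasureTheory Filter Topology
open Literature.Probability.LatticeModels

/-- `(−n,0,0) − (n,0,0) = −(2n) e₀`. [folklore] -/
theorem mirror_sub_deepSite (n : ℕ) :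
    (Fin.cons (-(n : ℤ)) 0 : Site 3) - deepSite n = -(Pi.single 0 ((2 * n : ℕ) : ℤ)) := by
  funext i
  refine Fin.cases ?_ (fun j => ?_) i
  · simp [deepSite]; ring
  · simp [deepSite, Fin.succ_ne_zero]

/-- `(0,u) − (n,0,0) = (−n, u)`. [folklore] -/
theorem layerSite_sub_deepSite (n : ℕ) (u : Fin 2 → ℤ) :
    layerSite u - deepSite n = Fin.cons (-(n : ℤ)) u := by
  funext i
  refine Fin.cases ?_ (fun j => ?_) i
  · simp [deepSite, layerSite]
  · simp [deepSite, layerSite]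

/-- `(0,v) − (0,u) = −(0, u − v)`. [folklore] -/
theorem layerSite_sub_layerSite (u v : Fin 2 → ℤ) :
    layerSite v - layerSite u = -(Fin.cons 0 (u - v) : Site 3) := by
  funext i
  refine Fin.cases ?_ (fun j => ?_) i
  · simp [layerSite]
  · simp [layerSite]

/-- Reflection in the `0`-th coordinate hyperplane: `⟨σ₀σ_{(−n,u)}⟩⁺_{β_c} = ⟨σ₀σ_{(n,u)}⟩⁺_{β_c}`
(`twoPointPlus_reflection_invariant_holds`). [cite: FriedliVelenik2017, Exercise 3.14, p. 115] -/
theorem criticalTwoPoint_cons_neg (n : ℕ) (u : Fin 2 → ℤ) :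
    criticalTwoPoint 3 (Fin.cons (-(n : ℤ)) u) = criticalTwoPoint 3 (Fin.cons (n : ℤ) u) := by
  have h := twoPointPlus_reflection_invariant_holds (d := 3) (criticalBeta_nonneg 3) 0 (Fin.cons (n : ℤ) u)
  have e : Function.update (Fin.cons (n : ℤ) u : Site 3) 0 (-(Fin.cons (n : ℤ) u : Site 3) 0) =
      Fin.cons (-(n : ℤ)) u := by
    rw [Fin.cons_zero, Fin.update_cons_zero]
  rw [e] at h
  exact h

/-- **M from M1 + M2** (the planner's / lead c1's registered `stub_markovRegression`, now a theorem modulo the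
two registered stubs above): the residual is `E_L[m_L²] − 2Σc_u⟨σ_xσ_{(0,u)}⟩_L + ΣΣc_uc_v⟨σ_{(0,u)}σ_{(0,v)}⟩_L`
(M2a), its first term is eventually `⟨σ_xσ_{θx}⟩_L` (M1), and the three box expectations converge (M2b) to
`G(2n e₀)`, `G(n,u)`, `G(0,u−v)` after the lattice symmetries `G(−x) = G(x)` (`criticalTwoPoint_neg`) and
`G(−n,u) = G(n,u)` (`criticalTwoPoint_cons_neg`). [folklore] -/
theorem markovRegression_of_stubs
    (hM1 : ∀ n : ℕ, ∀ᶠ L : ℕ in atTop,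
      ∫ σ, regression n L σ ^ 2 ∂(boxMeasure L) =
        isingExpect (zdGraph 3) (box 3 L) (criticalBeta 3) 0 BoundaryCondition.plus
          (spinPair (deepSite n) (Fin.cons (-(n : ℤ)) 0)))
    (hM2 : (∀ (n : ℕ) (s : Finset (Fin 2 → ℤ)) (c : (Fin 2 → ℤ) → ℝ) (L : ℕ),
      msResidual n s c L =
        (∫ σ, regression n L σ ^ 2 ∂(boxMeasure L))
          - 2 * ∑ u ∈ s, c u * isingExpect (zdGraph 3) (box 3 L) (criticalBeta 3) 0 BoundaryCondition.plus
              (spinPair (deepSite n) (layerSite u))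
          + ∑ u ∈ s, ∑ v ∈ s, c u * c v * isingExpect (zdGraph 3) (box 3 L) (criticalBeta 3) 0
              BoundaryCondition.plus (spinPair (layerSite u) (layerSite v))) ∧
    (∀ x y : Site 3, Tendsto (fun L : ℕ => isingExpect (zdGraph 3) (box 3 L) (criticalBeta 3) 0
        BoundaryCondition.plus (spinPair x y)) atTop (𝓝 (criticalTwoPoint 3 (y - x))))) :
    ∀ (n : ℕ) (s : Finset (Fin 2 → ℤ)) (c : (Fin 2 → ℤ) → ℝ),
      Tendsto (msResidual n s c) atTop (𝓝 (layerRegressionForm n s c)) := by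
  intro n s c
  obtain ⟨hexp, hlimit⟩ := hM2
  -- the three limits, with the lattice symmetries
  have hA : Tendsto (fun L : ℕ => ∫ σ, regression n L σ ^ 2 ∂(boxMeasure L)) atTop
      (𝓝 (criticalTwoPoint 3 (Pi.single 0 ((2 * n : ℕ) : ℤ)))) := by
    have h := hlimit (deepSite n) (Fin.cons (-(n : ℤ)) 0)
    rw [mirror_sub_deepSite, criticalTwoPoint_neg] at h
    refine h.congr' ?_
    filter_upwards [hM1 n] with L hL
    exact hL.symm
  have hB : Tendsto (fun L : ℕ => ∑ u ∈ s, c u * isingExpect (zdGraph 3) (box 3 L) (criticalBeta 3) 0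
      BoundaryCondition.plus (spinPair (deepSite n) (layerSite u))) atTop
      (𝓝 (∑ u ∈ s, c u * criticalTwoPoint 3 (Fin.cons (n : ℤ) u))) := by
    refine tendsto_finsetSum _ fun u _ => ?_
    have h := hlimit (deepSite n) (layerSite u)
    rw [layerSite_sub_deepSite, criticalTwoPoint_cons_neg] at h
    exact h.const_mul _
  have hC : Tendsto (fun L : ℕ => ∑ u ∈ s, ∑ v ∈ s, c u * c v * isingExpect (zdGraph 3) (box 3 L)
      (criticalBeta 3) 0 BoundaryCondition.plus (spinPair (layerSite u) (layerSite v))) atTop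
      (𝓝 (∑ u ∈ s, ∑ v ∈ s, c u * c v * criticalTwoPoint 3 (Fin.cons 0 (u - v)))) := by
    refine tendsto_finsetSum _ fun u _ => tendsto_finsetSum _ fun v _ => ?_
    have h := hlimit (layerSite u) (layerSite v)
    rw [layerSite_sub_layerSite, criticalTwoPoint_neg] at h
    exact h.const_mul _
  have h := (hA.sub (hB.const_mul 2)).add hC
  simp only [layerRegressionForm]
  refine h.congr' (Eventually.of_forall fun L => ?_)
  exact (hexp n s c L).symm

/-- **The planner's stub M `stub_markovRegression` as a THEOREM**: for every depth `n`, finite transverse support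
`s` and coefficients `c`, the mean-square residual `E_L[(E_L[σ_{(n,0,0)}|layer] − Σ_{u∈s} c_uσ_{(0,u)})²]` of the
critical plus measure on `[-L,L]³` converges, as `L → ∞`, to the two-point regression form
`layerRegressionForm n s c` (M1 p128323 + M2 p127710 + the glue above).
[cite: GlimmJaffe1987, §6.1 Remark 'Transfer matrix of statistical physics', pp. 89–90] -/
theorem stub_markovRegression :
    ∀ (n : ℕ) (s : Finset (Fin 2 → ℤ)) (c : (Fin 2 → ℤ) → ℝ),
      Tendsto (msResidual n s c) atTop (𝓝 (layerRegressionForm n s c)) :=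
  markovRegression_of_stubs stub_markovSquare stub_regressionMoments

end Summit.CriticalPhenomena.Ising3DConformalLimit.Cruxes.GaussianLimitNotScreened.SingleLayerLinearRegression

end
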